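import Literature.MathematicalPhysics.QuantumLattice.FermiRG.FST2VolumeBoundLemmas
import HarnessLib

/-!
# Feldman–Salmhofer–Trubowitz II, Appendix B: the linear normalisation made quantitative

Topic `Literature/MathematicalPhysics/QuantumLattice/FermiRG`; a THEOREM-ONLY continuation of
`FST2VolumeBoundLemmas.lean` (split off for file size). Source: [II] J. Feldman, M. Salmhofer,
E. Trubowitz, *Perturbation theory around non-nested Fermi surfaces II*, Comm. Pure Appl. Math.
**51** (1998), arXiv:cond-mat/9701073 (`FeldmanSalmhoferTrubowitz1998`), Appendix B, the
singular region around a non-degenerate critical point of `η` (p.34 L60–p.35 L112 of the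
`lit read arxiv:cond-mat/9701073` render): "rotate so that `𝒪 D₀ 𝒪⁻¹ = diag(d₁, d₂)`, rescale
by `|dᵢ|^{1/2}`; the Jacobian of this linear transformation is `|det D₀|^{-1/2} ≤ 2/|w₀|`"
(p.35 L47–80), after which the `C²` Morse lemma and the model integrals give
`Const ε |log ε|` (p.35 L81–112).

`FST2VolumeBoundLemmas` proves the model and Morse-lemma bounds, and QUANTITATIVE bounds whose
constants come from Hessian data only: `volume_band_le_of_posDef/negDef_hessian_at` (elliptic,
from the Hessian ENTRIES at the point) and `volume_band_le_of_saddle(_log)` (hyperbolic, but in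
the COORDINATE directions). This file closes the remaining local gap — the hyperbolic bound from
the Hessian ENTRIES at the point, i.e. the linear normalisation step made explicit and
quantitative — so that every non-degenerate critical point is covered with constants depending
only on `(|det D₀|, |e|₂, a modulus-of-continuity radius, the oscillation)`, uniformly over
families sharing these data (the uniformity in `q ∈ 𝒫_κ` that App. B takes from compactness
and "continuity of `D`", p.34 L40–58, p.35 L45–47).

The transport tools are in `FST2VolumeBoundLemmas` (`volume_affine_image_inter_band`: band
volumes under an affine change of variables, `|det L|` factor; `volume_band_le_of_saddle_dir`
(+ `_log`) and `volume_ball_band_le_of_saddle_dir_log`: the saddle bound in two arbitrary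
directions `u, v` on the parallelogram `p₀ + [-σ,σ]u + [-σ,σ]v`, factor `|u₁v₂ - u₂v₁|`).

## What is proved (sorry-free theorems; no definitions, no named facts)

* `volume_ball_band_le_of_indefHessian_at` — **the quantitative hyperbolic bound from the
  Hessian entries**: `ν ∈ C²`, entries `a, b, c` of `D²ν(p₀)` with `|a|,|b|,|c| ≤ K`,
  `ac - b² ≤ -w < 0`, `‖D²ν(p) - D²ν(p₀)‖ ≤ λ₀` on `B_{r₀}(p₀)` with `λ₀ ≤ √w/8`,
  `λ₀K² ≤ w√w/8`, oscillation `≤ Ω` ⇒ for all `f₀` and `0 < ε ≤ 1/2`,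
  `vol{p ∈ B_r(p₀) : |f₀ + ν p| ≤ ε} ≤ (C_A + C_C)·ε(1+|log ε|)`,
  `r = min(r₀(√w/4)/(2(K+1)(2K+1)), r₀/8)`, `C_A = K(80+35log(Ω+1))/((√w/4)·min(1,w)/2)`,
  `C_C = 2(80+35log(Ω+1))/(√w/2)`. The cases are separate theorems: `…_indefHessian_fst`
  (`a ≥ λ₁`: directions `v = (1,0)`, `u = (-b,a)` with `D²ν(p₀)(u,u) = a(ac-b²) ≤ -λ₁w`),
  `…_snd` (`c ≥ λ₁`: `v = (0,1)`, `u = (c,-b)`), `…_fst_neg` / `…_snd_neg` (via `-ν`), and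
  `…_diag` (directions `(1, ±1)`, used when `|a|,|c| < λ₁ = √w/4`, where `|b| ≥ 3√w/4`).
  No critical point is required (the saddle mechanism needs none); at a critical point of
  App. B the oscillation is bounded by `2|e|₀`.

## Faithfulness notes

* [II] normalises by an orthogonal diagonalisation of `D₀`; here explicit shears / diagonal
  directions replace the eigenvectors — the outcome (a bound `Const·ε|log ε|` with `Const`
  controlled by `|det D₀|^{-1/2}`-type quantities) is the printed one, with explicit, non-optimal
  constants. All balls are sup-norm balls of `ℝ × ℝ`.
* With `FST2VolumeBoundLemmas` this completes the LOCAL/ANALYTIC half of App. B for `d = 2` in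
  quantitative form; the GLOBAL half (coordinates of [I, Lemma 2.1], the curves `ϑ^{(k)}`,
  `𝒫_κ`, the finite cover, `|det D₀| ≥ ⅜w₀²`, assembly, `d ≥ 3`) is not here and `VolumeBound`
  stays a named fact. Nothing is asserted about [II]'s hypotheses.
-/

noncomputable section

open Set Filter MeasureTheory
open scoped NNReal ENNReal Topology

namespace Literature.MathematicalPhysics.QuantumLattice.FermiRG



section IndefiniteHessian

variable {ν : ℝ × ℝ → ℝ}

/-- A bilinear map on `ℝ × ℝ` in coordinates (as in `FST2VolumeBoundLemmas`). [folklore] -/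
private theorem bilin_coord (B : ℝ × ℝ →L[ℝ] ℝ × ℝ →L[ℝ] ℝ) (u w : ℝ × ℝ) :
    B u w = u.1 * w.1 * B (1, 0) (1, 0) + u.1 * w.2 * B (1, 0) (0, 1)
      + u.2 * w.1 * B (0, 1) (1, 0) + u.2 * w.2 * B (0, 1) (0, 1) := by
  have hu : u = u.1 • ((1 : ℝ), (0 : ℝ)) + u.2 • ((0 : ℝ), (1 : ℝ)) := by ext <;> simp
  have hw : w = w.1 • ((1 : ℝ), (0 : ℝ)) + w.2 • ((0 : ℝ), (1 : ℝ)) := by ext <;> simp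
  conv_lhs => rw [hu, hw]
  simp only [map_add, map_smul, add_apply, smul_apply, smul_eq_mul]
  ring

/-- Deviation of the second derivative along a direction from its value at `p₀`. [folklore] -/
private theorem fderiv2_sub_le_of_opNorm (ν : ℝ × ℝ → ℝ) (p p₀ z : ℝ × ℝ) {lam₀ : ℝ}
    (h : ‖fderiv ℝ (fderiv ℝ ν) p - fderiv ℝ (fderiv ℝ ν) p₀‖ ≤ lam₀) :
    |fderiv ℝ (fderiv ℝ ν) p z z - fderiv ℝ (fderiv ℝ ν) p₀ z z| ≤ lam₀ * (‖z‖ * ‖z‖) := by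
  have h1 : fderiv ℝ (fderiv ℝ ν) p z z - fderiv ℝ (fderiv ℝ ν) p₀ z z =
      (fderiv ℝ (fderiv ℝ ν) p - fderiv ℝ (fderiv ℝ ν) p₀) z z := by
    rw [sub_apply, sub_apply]
  rw [h1, ← Real.norm_eq_abs]
  calc ‖(fderiv ℝ (fderiv ℝ ν) p - fderiv ℝ (fderiv ℝ ν) p₀) z z‖
      ≤ ‖fderiv ℝ (fderiv ℝ ν) p - fderiv ℝ (fderiv ℝ ν) p₀‖ * ‖z‖ * ‖z‖ :=
        ContinuousLinearMap.le_opNorm₂ _ _ _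
    _ ≤ lam₀ * (‖z‖ * ‖z‖) := by
        rw [mul_assoc]
        exact mul_le_mul_of_nonneg_right h (by positivity)

/-- **Quantitative hyperbolic bound from the Hessian entries — the case `∂₁²ν(p₀) ≥ λ₁ > 0`**
(App. B, p.35 L47–112, with the linear normalisation made explicit and quantitative; the other
sign/coordinate cases reduce to this one by `ν ↦ -ν` and `θ₁ ↔ θ₂`, and the case of two small
diagonal entries uses the directions `(1, ±1)` — see the module docstring). Data at the point
`p₀`: `a = ∂₁²ν(p₀) ≥ λ₁`, `|a|, |b| ≤ K` (`b = ∂₁∂₂ν(p₀)`), `ac - b² ≤ -w < 0`; on the sup-norm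
ball `B_{r₀}(p₀)`: `‖D²ν(p) - D²ν(p₀)‖ ≤ λ₀` with `λ₀ ≤ λ₁/2` and `λ₀K² ≤ λ₁w/2`, and
oscillation `≤ Ω`. Directions: `v = (1,0)` (`D²ν(p₀)(v,v) = a ≥ λ₁`) and `u = (-b, a)`
(`D²ν(p₀)(u,u) = a(ac - b²) ≤ -λ₁w`), parallelogram of size `σ = r₀/(2(K+1))` inside the ball;
`volume_ball_band_le_of_saddle_dir_log` then gives, for all `f₀` and `0 < ε ≤ 1/2`,
`vol{p ∈ B_r(p₀) : |f₀ + ν p| ≤ ε} ≤ K·((80 + 35 log(Ω+1))/λ)·ε(1+|log ε|)` with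
`λ = λ₁·min(1,w)/2` and `r = r₀λ₁/(2(K+1)(2K+1))` — constants from `(λ₁, w, K, r₀, Ω)` only.
[cite: FeldmanSalmhoferTrubowitz1998, App. B (arXiv p.35 L47–112)] -/
theorem volume_ball_band_le_of_indefHessian_fst (hν : ContDiff ℝ 2 ν) (p₀ : ℝ × ℝ)
    {r₀ w K lam₁ lam₀ Ω : ℝ} (hr₀ : 0 < r₀) (hw : 0 < w) (hK : 0 < K) (hlam₁ : 0 < lam₁)
    (ha : lam₁ ≤ fderiv ℝ (fderiv ℝ ν) p₀ ((1 : ℝ), (0 : ℝ)) ((1 : ℝ), (0 : ℝ)))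
    (haK : |fderiv ℝ (fderiv ℝ ν) p₀ ((1 : ℝ), (0 : ℝ)) ((1 : ℝ), (0 : ℝ))| ≤ K)
    (hbK : |fderiv ℝ (fderiv ℝ ν) p₀ ((1 : ℝ), (0 : ℝ)) ((0 : ℝ), (1 : ℝ))| ≤ K)
    (hdet : fderiv ℝ (fderiv ℝ ν) p₀ ((1 : ℝ), (0 : ℝ)) ((1 : ℝ), (0 : ℝ)) *
        fderiv ℝ (fderiv ℝ ν) p₀ ((0 : ℝ), (1 : ℝ)) ((0 : ℝ), (1 : ℝ)) -
        (fderiv ℝ (fderiv ℝ ν) p₀ ((1 : ℝ), (0 : ℝ)) ((0 : ℝ), (1 : ℝ))) ^ 2 ≤ -w)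
    (hmod : ∀ p ∈ Metric.ball p₀ r₀,
      ‖fderiv ℝ (fderiv ℝ ν) p - fderiv ℝ (fderiv ℝ ν) p₀‖ ≤ lam₀)
    (hlam₀ : lam₀ ≤ lam₁ / 2) (hlam₀' : lam₀ * K ^ 2 ≤ lam₁ * w / 2)
    (hosc : ∀ p ∈ Metric.ball p₀ r₀, ∀ q ∈ Metric.ball p₀ r₀, ν p - ν q ≤ Ω)
    (f₀ ε : ℝ) (hε : 0 < ε) (hε2 : ε ≤ 1 / 2) :
    volume (Metric.ball p₀ (r₀ * lam₁ / (2 * (K + 1) * (2 * K + 1))) ∩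
        {p : ℝ × ℝ | |f₀ + ν p| ≤ ε}) ≤
      ENNReal.ofReal (K * ((80 + 35 * Real.log (Ω + 1)) / (lam₁ * min 1 w / 2) * ε *
        (1 + |Real.log ε|))) := by
  set H := fderiv ℝ (fderiv ℝ ν) p₀ with hH
  set a := H ((1 : ℝ), (0 : ℝ)) ((1 : ℝ), (0 : ℝ)) with ha'
  set b := H ((1 : ℝ), (0 : ℝ)) ((0 : ℝ), (1 : ℝ)) with hb'
  set c := H ((0 : ℝ), (1 : ℝ)) ((0 : ℝ), (1 : ℝ)) with hc'
  have hsymm : IsSymmSndFDerivAt ℝ ν p₀ := hν.contDiffAt.isSymmSndFDerivAt (by simp)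
  have hba : H ((0 : ℝ), (1 : ℝ)) ((1 : ℝ), (0 : ℝ)) = b := hsymm _ _
  have hapos : 0 < a := lt_of_lt_of_le hlam₁ ha
  have haK' : a ≤ K := (le_abs_self a).trans haK
  have hlam₀nn : 0 ≤ lam₀ :=
    le_trans (norm_nonneg (fderiv ℝ (fderiv ℝ ν) p₀ - H)) (hmod p₀ (Metric.mem_ball_self hr₀))
  -- directions and sizes
  set u : ℝ × ℝ := (-b, a) with hu
  set v : ℝ × ℝ := ((1 : ℝ), (0 : ℝ)) with hv
  set σ := r₀ / (2 * (K + 1)) with hσ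
  have hσpos : 0 < σ := by positivity
  set lam := lam₁ * min 1 w / 2 with hlam
  have hmin1 : min 1 w ≤ 1 := min_le_left _ _
  have hminw : min 1 w ≤ w := min_le_right _ _
  have hminpos : 0 < min 1 w := lt_min one_pos hw
  have hlampos : 0 < lam := by positivity
  have hnu : ‖u‖ ≤ K := by
    rw [hu, Prod.norm_def, Real.norm_eq_abs, Real.norm_eq_abs, abs_neg]
    exact max_le hbK (by rw [abs_of_pos hapos]; exact haK')
  have hnv : ‖v‖ = 1 := by simp [hv, Prod.norm_def]
  -- the parallelogram lies in the ball
  have hP : ∀ x ∈ Icc (-σ) σ ×ˢ Icc (-σ) σ, p₀ + (x.1 • u + x.2 • v) ∈ Metric.ball p₀ r₀ := by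
    rintro x ⟨⟨h1, h2⟩, ⟨h3, h4⟩⟩
    rw [Metric.mem_ball, dist_eq_norm, add_sub_cancel_left]
    have hx1 : |x.1| ≤ σ := abs_le.2 ⟨h1, h2⟩
    have hx2 : |x.2| ≤ σ := abs_le.2 ⟨h3, h4⟩
    calc ‖x.1 • u + x.2 • v‖ ≤ ‖x.1 • u‖ + ‖x.2 • v‖ := norm_add_le _ _
      _ = |x.1| * ‖u‖ + |x.2| * ‖v‖ := by rw [norm_smul, norm_smul, Real.norm_eq_abs, Real.norm_eq_abs]
      _ ≤ σ * K + σ * 1 := by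
          rw [hnv]
          gcongr
      _ = r₀ / 2 := by rw [hσ]; field_simp
      _ < r₀ := by linarith
  -- Hessian values at p₀
  have hHv : H v v = a := by rw [hv]
  have hHu : H u u = a * (a * c - b ^ 2) := by
    rw [bilin_coord H u u, hba]
    simp only [hu]
    ring
  have hHu' : H u u ≤ -(lam₁ * w) := by
    rw [hHu]
    have h1 : a * (a * c - b ^ 2) ≤ lam₁ * (a * c - b ^ 2) :=
      mul_le_mul_of_nonpos_right ha (by linarith)
    have h2 : lam₁ * (a * c - b ^ 2) ≤ lam₁ * (-w) := mul_le_mul_of_nonneg_left hdet hlam₁.le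
    linarith
  -- hypotheses of the directional lemma
  have hvv : ∀ x ∈ Icc (-σ) σ ×ˢ Icc (-σ) σ,
      lam ≤ fderiv ℝ (fderiv ℝ ν) (p₀ + (x.1 • u + x.2 • v)) v v := by
    intro x hx
    have hdev := fderiv2_sub_le_of_opNorm ν _ p₀ v (hmod _ (hP x hx))
    rw [hnv, mul_one, mul_one] at hdev
    have := (abs_sub_le_iff.1 hdev).2
    rw [← hH, hHv] at this
    have hl : lam ≤ lam₁ / 2 := by
      rw [hlam]
      have := mul_le_mul_of_nonneg_left hmin1 hlam₁.le
      linarith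
    linarith
  have huu : ∀ x ∈ Icc (-σ) σ ×ˢ Icc (-σ) σ,
      fderiv ℝ (fderiv ℝ ν) (p₀ + (x.1 • u + x.2 • v)) u u ≤ -lam := by
    intro x hx
    have hdev := fderiv2_sub_le_of_opNorm ν _ p₀ u (hmod _ (hP x hx))
    have hKK : lam₀ * (‖u‖ * ‖u‖) ≤ lam₀ * K ^ 2 := by
      rw [sq]
      exact mul_le_mul_of_nonneg_left
        (mul_le_mul hnu hnu (norm_nonneg _) hK.le) hlam₀nn
    have := (abs_sub_le_iff.1 hdev).1
    rw [← hH] at this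
    have hl : lam ≤ lam₁ * w / 2 := by
      rw [hlam]
      have := mul_le_mul_of_nonneg_left hminw hlam₁.le
      linarith
    linarith
  have hosc' : ∀ x ∈ Icc (-σ) σ ×ˢ Icc (-σ) σ, ∀ y ∈ Icc (-σ) σ ×ˢ Icc (-σ) σ,
      ν (p₀ + (x.1 • u + x.2 • v)) - ν (p₀ + (y.1 • u + y.2 • v)) ≤ Ω :=
    fun x hx y hy => hosc _ (hP x hx) _ (hP y hy)
  have hdetuv : u.1 * v.2 - u.2 * v.1 = -a := by simp [hu, hv]
  have hdet0 : u.1 * v.2 - u.2 * v.1 ≠ 0 := by rw [hdetuv]; exact neg_ne_zero.2 hapos.ne'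
  have hr : r₀ * lam₁ / (2 * (K + 1) * (2 * K + 1)) * (|u.1| + |u.2| + |v.1| + |v.2|) ≤
      σ * |u.1 * v.2 - u.2 * v.1| := by
    have hcomp : |u.1| + |u.2| + |v.1| + |v.2| = |b| + a + 1 := by
      simp only [hu, hv, abs_neg, abs_zero, abs_one, add_zero, abs_of_pos hapos]
    rw [hcomp, hdetuv, abs_neg, abs_of_pos hapos]
    have hb : |b| ≤ K := hbK
    have h1 : |b| + a + 1 ≤ 2 * K + 1 := by linarith
    calc r₀ * lam₁ / (2 * (K + 1) * (2 * K + 1)) * (|b| + a + 1)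
        ≤ r₀ * lam₁ / (2 * (K + 1) * (2 * K + 1)) * (2 * K + 1) := by gcongr
      _ = σ * lam₁ := by rw [hσ]; field_simp
      _ ≤ σ * a := by gcongr
  have h := volume_ball_band_le_of_saddle_dir_log hν p₀ u v hσpos hlampos hdet0 hr hvv huu hosc'
    f₀ ε hε hε2
  refine h.trans (ENNReal.ofReal_le_ofReal ?_)
  rw [hdetuv, abs_neg, abs_of_pos hapos]
  have hΩ : 0 ≤ Ω := by
    have := hosc p₀ (Metric.mem_ball_self hr₀) p₀ (Metric.mem_ball_self hr₀); linarith
  have hQ : 0 ≤ (80 + 35 * Real.log (Ω + 1)) / (lam₁ * min 1 w / 2) * ε * (1 + |Real.log ε|) := by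
    have : 0 ≤ Real.log (Ω + 1) := Real.log_nonneg (by linarith)
    positivity
  exact mul_le_mul_of_nonneg_right haK' hQ

/-- **Quantitative hyperbolic bound from the Hessian entries — the case `∂₂²ν(p₀) ≥ λ₁ > 0`**
(App. B, p.35 L47–112, with the linear normalisation made explicit and quantitative; the other
sign/coordinate cases reduce to this one by `ν ↦ -ν` and `θ₁ ↔ θ₂`, and the case of two small
diagonal entries uses the directions `(1, ±1)` — see the module docstring). Data at the point
`p₀`: `c = ∂₂²ν(p₀) ≥ λ₁`, `|c|, |b| ≤ K` (`b = ∂₁∂₂ν(p₀)`), `ac - b² ≤ -w < 0`; on the sup-norm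
ball `B_{r₀}(p₀)`: `‖D²ν(p) - D²ν(p₀)‖ ≤ λ₀` with `λ₀ ≤ λ₁/2` and `λ₀K² ≤ λ₁w/2`, and
oscillation `≤ Ω`. Directions: `v = (0,1)` (`D²ν(p₀)(v,v) = c ≥ λ₁`) and `u = (c, -b)`
(`D²ν(p₀)(u,u) = c(ac - b²) ≤ -λ₁w`), parallelogram of size `σ = r₀/(2(K+1))` inside the ball;
`volume_ball_band_le_of_saddle_dir_log` then gives, for all `f₀` and `0 < ε ≤ 1/2`,
`vol{p ∈ B_r(p₀) : |f₀ + ν p| ≤ ε} ≤ K·((80 + 35 log(Ω+1))/λ)·ε(1+|log ε|)` with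
`λ = λ₁·min(1,w)/2` and `r = r₀λ₁/(2(K+1)(2K+1))` — constants from `(λ₁, w, K, r₀, Ω)` only.
[cite: FeldmanSalmhoferTrubowitz1998, App. B (arXiv p.35 L47–112)] -/
theorem volume_ball_band_le_of_indefHessian_snd (hν : ContDiff ℝ 2 ν) (p₀ : ℝ × ℝ)
    {r₀ w K lam₁ lam₀ Ω : ℝ} (hr₀ : 0 < r₀) (hw : 0 < w) (hK : 0 < K) (hlam₁ : 0 < lam₁)
    (hc : lam₁ ≤ fderiv ℝ (fderiv ℝ ν) p₀ ((0 : ℝ), (1 : ℝ)) ((0 : ℝ), (1 : ℝ)))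
    (hcK : |fderiv ℝ (fderiv ℝ ν) p₀ ((0 : ℝ), (1 : ℝ)) ((0 : ℝ), (1 : ℝ))| ≤ K)
    (hbK : |fderiv ℝ (fderiv ℝ ν) p₀ ((1 : ℝ), (0 : ℝ)) ((0 : ℝ), (1 : ℝ))| ≤ K)
    (hdet : fderiv ℝ (fderiv ℝ ν) p₀ ((1 : ℝ), (0 : ℝ)) ((1 : ℝ), (0 : ℝ)) *
        fderiv ℝ (fderiv ℝ ν) p₀ ((0 : ℝ), (1 : ℝ)) ((0 : ℝ), (1 : ℝ)) -
        (fderiv ℝ (fderiv ℝ ν) p₀ ((1 : ℝ), (0 : ℝ)) ((0 : ℝ), (1 : ℝ))) ^ 2 ≤ -w)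
    (hmod : ∀ p ∈ Metric.ball p₀ r₀,
      ‖fderiv ℝ (fderiv ℝ ν) p - fderiv ℝ (fderiv ℝ ν) p₀‖ ≤ lam₀)
    (hlam₀ : lam₀ ≤ lam₁ / 2) (hlam₀' : lam₀ * K ^ 2 ≤ lam₁ * w / 2)
    (hosc : ∀ p ∈ Metric.ball p₀ r₀, ∀ q ∈ Metric.ball p₀ r₀, ν p - ν q ≤ Ω)
    (f₀ ε : ℝ) (hε : 0 < ε) (hε2 : ε ≤ 1 / 2) :
    volume (Metric.ball p₀ (r₀ * lam₁ / (2 * (K + 1) * (2 * K + 1))) ∩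
        {p : ℝ × ℝ | |f₀ + ν p| ≤ ε}) ≤
      ENNReal.ofReal (K * ((80 + 35 * Real.log (Ω + 1)) / (lam₁ * min 1 w / 2) * ε *
        (1 + |Real.log ε|))) := by
  set H := fderiv ℝ (fderiv ℝ ν) p₀ with hH
  set a := H ((1 : ℝ), (0 : ℝ)) ((1 : ℝ), (0 : ℝ)) with ha'
  set b := H ((1 : ℝ), (0 : ℝ)) ((0 : ℝ), (1 : ℝ)) with hb'
  set c := H ((0 : ℝ), (1 : ℝ)) ((0 : ℝ), (1 : ℝ)) with hc'
  have hsymm : IsSymmSndFDerivAt ℝ ν p₀ := hν.contDiffAt.isSymmSndFDerivAt (by simp)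
  have hba : H ((0 : ℝ), (1 : ℝ)) ((1 : ℝ), (0 : ℝ)) = b := hsymm _ _
  have hcpos : 0 < c := lt_of_lt_of_le hlam₁ hc
  have hcK' : c ≤ K := (le_abs_self c).trans hcK
  have hlam₀nn : 0 ≤ lam₀ :=
    le_trans (norm_nonneg (fderiv ℝ (fderiv ℝ ν) p₀ - H)) (hmod p₀ (Metric.mem_ball_self hr₀))
  -- directions and sizes
  set u : ℝ × ℝ := (c, -b) with hu
  set v : ℝ × ℝ := ((0 : ℝ), (1 : ℝ)) with hv
  set σ := r₀ / (2 * (K + 1)) with hσ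
  have hσpos : 0 < σ := by positivity
  set lam := lam₁ * min 1 w / 2 with hlam
  have hmin1 : min 1 w ≤ 1 := min_le_left _ _
  have hminw : min 1 w ≤ w := min_le_right _ _
  have hminpos : 0 < min 1 w := lt_min one_pos hw
  have hlampos : 0 < lam := by positivity
  have hnu : ‖u‖ ≤ K := by
    rw [hu, Prod.norm_def, Real.norm_eq_abs, Real.norm_eq_abs, abs_neg]
    exact max_le (by rw [abs_of_pos hcpos]; exact hcK') hbK
  have hnv : ‖v‖ = 1 := by simp [hv, Prod.norm_def]
  -- the parallelogram lies in the ball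
  have hP : ∀ x ∈ Icc (-σ) σ ×ˢ Icc (-σ) σ, p₀ + (x.1 • u + x.2 • v) ∈ Metric.ball p₀ r₀ := by
    rintro x ⟨⟨h1, h2⟩, ⟨h3, h4⟩⟩
    rw [Metric.mem_ball, dist_eq_norm, add_sub_cancel_left]
    have hx1 : |x.1| ≤ σ := abs_le.2 ⟨h1, h2⟩
    have hx2 : |x.2| ≤ σ := abs_le.2 ⟨h3, h4⟩
    calc ‖x.1 • u + x.2 • v‖ ≤ ‖x.1 • u‖ + ‖x.2 • v‖ := norm_add_le _ _
      _ = |x.1| * ‖u‖ + |x.2| * ‖v‖ := by rw [norm_smul, norm_smul, Real.norm_eq_abs, Real.norm_eq_abs]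
      _ ≤ σ * K + σ * 1 := by
          rw [hnv]
          gcongr
      _ = r₀ / 2 := by rw [hσ]; field_simp
      _ < r₀ := by linarith
  -- Hessian values at p₀
  have hHv : H v v = c := by rw [hv]
  have hHu : H u u = c * (a * c - b ^ 2) := by
    rw [bilin_coord H u u, hba]
    simp only [hu]
    ring
  have hHu' : H u u ≤ -(lam₁ * w) := by
    rw [hHu]
    have h1 : c * (a * c - b ^ 2) ≤ lam₁ * (a * c - b ^ 2) :=
      mul_le_mul_of_nonpos_right hc (by linarith)
    have h2 : lam₁ * (a * c - b ^ 2) ≤ lam₁ * (-w) := mul_le_mul_of_nonneg_left hdet hlam₁.le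
    linarith
  -- hypotheses of the directional lemma
  have hvv : ∀ x ∈ Icc (-σ) σ ×ˢ Icc (-σ) σ,
      lam ≤ fderiv ℝ (fderiv ℝ ν) (p₀ + (x.1 • u + x.2 • v)) v v := by
    intro x hx
    have hdev := fderiv2_sub_le_of_opNorm ν _ p₀ v (hmod _ (hP x hx))
    rw [hnv, mul_one, mul_one] at hdev
    have := (abs_sub_le_iff.1 hdev).2
    rw [← hH, hHv] at this
    have hl : lam ≤ lam₁ / 2 := by
      rw [hlam]
      have := mul_le_mul_of_nonneg_left hmin1 hlam₁.le
      linarith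
    linarith
  have huu : ∀ x ∈ Icc (-σ) σ ×ˢ Icc (-σ) σ,
      fderiv ℝ (fderiv ℝ ν) (p₀ + (x.1 • u + x.2 • v)) u u ≤ -lam := by
    intro x hx
    have hdev := fderiv2_sub_le_of_opNorm ν _ p₀ u (hmod _ (hP x hx))
    have hKK : lam₀ * (‖u‖ * ‖u‖) ≤ lam₀ * K ^ 2 := by
      rw [sq]
      exact mul_le_mul_of_nonneg_left
        (mul_le_mul hnu hnu (norm_nonneg _) hK.le) hlam₀nn
    have := (abs_sub_le_iff.1 hdev).1
    rw [← hH] at this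
    have hl : lam ≤ lam₁ * w / 2 := by
      rw [hlam]
      have := mul_le_mul_of_nonneg_left hminw hlam₁.le
      linarith
    linarith
  have hosc' : ∀ x ∈ Icc (-σ) σ ×ˢ Icc (-σ) σ, ∀ y ∈ Icc (-σ) σ ×ˢ Icc (-σ) σ,
      ν (p₀ + (x.1 • u + x.2 • v)) - ν (p₀ + (y.1 • u + y.2 • v)) ≤ Ω :=
    fun x hx y hy => hosc _ (hP x hx) _ (hP y hy)
  have hdetuv : u.1 * v.2 - u.2 * v.1 = c := by simp [hu, hv]
  have hdet0 : u.1 * v.2 - u.2 * v.1 ≠ 0 := by rw [hdetuv]; exact hcpos.ne'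
  have hr : r₀ * lam₁ / (2 * (K + 1) * (2 * K + 1)) * (|u.1| + |u.2| + |v.1| + |v.2|) ≤
      σ * |u.1 * v.2 - u.2 * v.1| := by
    have hcomp : |u.1| + |u.2| + |v.1| + |v.2| = c + |b| + 1 := by
      simp only [hu, hv, abs_neg, abs_zero, abs_one, add_zero, abs_of_pos hcpos]
    rw [hcomp, hdetuv, abs_of_pos hcpos]
    have hb : |b| ≤ K := hbK
    have h1 : c + |b| + 1 ≤ 2 * K + 1 := by linarith
    calc r₀ * lam₁ / (2 * (K + 1) * (2 * K + 1)) * (c + |b| + 1)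
        ≤ r₀ * lam₁ / (2 * (K + 1) * (2 * K + 1)) * (2 * K + 1) := by gcongr
      _ = σ * lam₁ := by rw [hσ]; field_simp
      _ ≤ σ * c := by gcongr
  have h := volume_ball_band_le_of_saddle_dir_log hν p₀ u v hσpos hlampos hdet0 hr hvv huu hosc'
    f₀ ε hε hε2
  refine h.trans (ENNReal.ofReal_le_ofReal ?_)
  rw [hdetuv, abs_of_pos hcpos]
  have hΩ : 0 ≤ Ω := by
    have := hosc p₀ (Metric.mem_ball_self hr₀) p₀ (Metric.mem_ball_self hr₀); linarith
  have hQ : 0 ≤ (80 + 35 * Real.log (Ω + 1)) / (lam₁ * min 1 w / 2) * ε * (1 + |Real.log ε|) := by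
    have : 0 ≤ Real.log (Ω + 1) := Real.log_nonneg (by linarith)
    positivity
  exact mul_le_mul_of_nonneg_right hcK' hQ


/-- **Quantitative hyperbolic bound from the Hessian entries — the case of the diagonal
directions `(1, ±1)`** (used when both `|∂₁²ν(p₀)|` and `|∂₂²ν(p₀)|` are small, so that
`|∂₁∂₂ν(p₀)|` is large: App. B p.35 L47–112 with the normalisation explicit). Data at `p₀`, with
`s = ±1`: `a + 2sb + c ≥ 2λ₂` and `a - 2sb + c ≤ -2λ₂` (`a, b, c` the Hessian entries); on the
sup-norm ball `B_{r₀}(p₀)`: `‖D²ν(p) - D²ν(p₀)‖ ≤ λ₀ ≤ λ₂` and oscillation `≤ Ω`. Directions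
`v = (1, s)`, `u = (1, -s)` (`D²ν(p₀)(v,v) = a + 2sb + c`, `D²ν(p₀)(u,u) = a - 2sb + c`,
`|u₁v₂ - u₂v₁| = 2`), `σ = r₀/4`; then for all `f₀` and `0 < ε ≤ 1/2`,
`vol{p ∈ B_{r₀/8}(p₀) : |f₀ + ν p| ≤ ε} ≤ 2·((80 + 35 log(Ω+1))/λ₂)·ε(1+|log ε|)`.
[cite: FeldmanSalmhoferTrubowitz1998, App. B (arXiv p.35 L47–112)] -/
theorem volume_ball_band_le_of_indefHessian_diag (hν : ContDiff ℝ 2 ν) (p₀ : ℝ × ℝ)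
    {r₀ lam₂ lam₀ Ω s : ℝ} (hr₀ : 0 < r₀) (hlam₂ : 0 < lam₂) (hs : s = 1 ∨ s = -1)
    (hvH : 2 * lam₂ ≤ fderiv ℝ (fderiv ℝ ν) p₀ ((1 : ℝ), (0 : ℝ)) ((1 : ℝ), (0 : ℝ)) +
        2 * s * fderiv ℝ (fderiv ℝ ν) p₀ ((1 : ℝ), (0 : ℝ)) ((0 : ℝ), (1 : ℝ)) +
        fderiv ℝ (fderiv ℝ ν) p₀ ((0 : ℝ), (1 : ℝ)) ((0 : ℝ), (1 : ℝ)))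
    (huH : fderiv ℝ (fderiv ℝ ν) p₀ ((1 : ℝ), (0 : ℝ)) ((1 : ℝ), (0 : ℝ)) -
        2 * s * fderiv ℝ (fderiv ℝ ν) p₀ ((1 : ℝ), (0 : ℝ)) ((0 : ℝ), (1 : ℝ)) +
        fderiv ℝ (fderiv ℝ ν) p₀ ((0 : ℝ), (1 : ℝ)) ((0 : ℝ), (1 : ℝ)) ≤ -(2 * lam₂))
    (hmod : ∀ p ∈ Metric.ball p₀ r₀,
      ‖fderiv ℝ (fderiv ℝ ν) p - fderiv ℝ (fderiv ℝ ν) p₀‖ ≤ lam₀)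
    (hlam₀ : lam₀ ≤ lam₂)
    (hosc : ∀ p ∈ Metric.ball p₀ r₀, ∀ q ∈ Metric.ball p₀ r₀, ν p - ν q ≤ Ω)
    (f₀ ε : ℝ) (hε : 0 < ε) (hε2 : ε ≤ 1 / 2) :
    volume (Metric.ball p₀ (r₀ / 8) ∩ {p : ℝ × ℝ | |f₀ + ν p| ≤ ε}) ≤
      ENNReal.ofReal (2 * ((80 + 35 * Real.log (Ω + 1)) / lam₂ * ε * (1 + |Real.log ε|))) := by
  set H := fderiv ℝ (fderiv ℝ ν) p₀ with hH
  set a := H ((1 : ℝ), (0 : ℝ)) ((1 : ℝ), (0 : ℝ)) with ha'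
  set b := H ((1 : ℝ), (0 : ℝ)) ((0 : ℝ), (1 : ℝ)) with hb'
  set c := H ((0 : ℝ), (1 : ℝ)) ((0 : ℝ), (1 : ℝ)) with hc'
  have hsymm : IsSymmSndFDerivAt ℝ ν p₀ := hν.contDiffAt.isSymmSndFDerivAt (by simp)
  have hba : H ((0 : ℝ), (1 : ℝ)) ((1 : ℝ), (0 : ℝ)) = b := hsymm _ _
  have hs1 : |s| = 1 := by rcases hs with h | h <;> simp [h]
  have hs2 : s * s = 1 := by rcases hs with h | h <;> norm_num [h]
  set u : ℝ × ℝ := ((1 : ℝ), -s) with hu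
  set v : ℝ × ℝ := ((1 : ℝ), s) with hv
  set σ := r₀ / 4 with hσ
  have hσpos : 0 < σ := by positivity
  have hnu : ‖u‖ = 1 := by
    rw [hu, Prod.norm_def, Real.norm_eq_abs, Real.norm_eq_abs, abs_neg, hs1, abs_one, max_self]
  have hnv : ‖v‖ = 1 := by
    rw [hv, Prod.norm_def, Real.norm_eq_abs, Real.norm_eq_abs, hs1, abs_one, max_self]
  have hP : ∀ x ∈ Icc (-σ) σ ×ˢ Icc (-σ) σ, p₀ + (x.1 • u + x.2 • v) ∈ Metric.ball p₀ r₀ := by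
    rintro x ⟨⟨h1, h2⟩, ⟨h3, h4⟩⟩
    rw [Metric.mem_ball, dist_eq_norm, add_sub_cancel_left]
    have hx1 : |x.1| ≤ σ := abs_le.2 ⟨h1, h2⟩
    have hx2 : |x.2| ≤ σ := abs_le.2 ⟨h3, h4⟩
    calc ‖x.1 • u + x.2 • v‖ ≤ ‖x.1 • u‖ + ‖x.2 • v‖ := norm_add_le _ _
      _ = |x.1| * ‖u‖ + |x.2| * ‖v‖ := by rw [norm_smul, norm_smul, Real.norm_eq_abs, Real.norm_eq_abs]
      _ ≤ σ * 1 + σ * 1 := by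
          rw [hnu, hnv]
          gcongr
      _ = r₀ / 2 := by rw [hσ]; ring
      _ < r₀ := by linarith
  have hHv : H v v = a + 2 * s * b + c := by
    rw [bilin_coord H v v, hba]
    simp only [hv]
    linear_combination c * hs2
  have hHu : H u u = a - 2 * s * b + c := by
    rw [bilin_coord H u u, hba]
    simp only [hu]
    linear_combination c * hs2
  have hvv : ∀ x ∈ Icc (-σ) σ ×ˢ Icc (-σ) σ,
      lam₂ ≤ fderiv ℝ (fderiv ℝ ν) (p₀ + (x.1 • u + x.2 • v)) v v := by
    intro x hx
    have hdev := fderiv2_sub_le_of_opNorm ν _ p₀ v (hmod _ (hP x hx))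
    rw [hnv, mul_one, mul_one] at hdev
    have := (abs_sub_le_iff.1 hdev).2
    rw [← hH, hHv] at this
    linarith
  have huu : ∀ x ∈ Icc (-σ) σ ×ˢ Icc (-σ) σ,
      fderiv ℝ (fderiv ℝ ν) (p₀ + (x.1 • u + x.2 • v)) u u ≤ -lam₂ := by
    intro x hx
    have hdev := fderiv2_sub_le_of_opNorm ν _ p₀ u (hmod _ (hP x hx))
    rw [hnu, mul_one, mul_one] at hdev
    have := (abs_sub_le_iff.1 hdev).1
    rw [← hH, hHu] at this
    linarith
  have hosc' : ∀ x ∈ Icc (-σ) σ ×ˢ Icc (-σ) σ, ∀ y ∈ Icc (-σ) σ ×ˢ Icc (-σ) σ,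
      ν (p₀ + (x.1 • u + x.2 • v)) - ν (p₀ + (y.1 • u + y.2 • v)) ≤ Ω :=
    fun x hx y hy => hosc _ (hP x hx) _ (hP y hy)
  have hdetuv : u.1 * v.2 - u.2 * v.1 = 2 * s := by simp [hu, hv]; ring
  have hs0 : s ≠ 0 := by rcases hs with h | h <;> norm_num [h]
  have hdet0 : u.1 * v.2 - u.2 * v.1 ≠ 0 := by rw [hdetuv]; positivity
  have habs2s : |2 * s| = 2 := by rw [abs_mul, hs1]; norm_num
  have hr : r₀ / 8 * (|u.1| + |u.2| + |v.1| + |v.2|) ≤ σ * |u.1 * v.2 - u.2 * v.1| := by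
    have hcomp : |u.1| + |u.2| + |v.1| + |v.2| = 4 := by
      simp only [hu, hv, abs_neg, abs_one, hs1]; norm_num
    rw [hcomp, hdetuv, habs2s, hσ]
    linarith
  have h := volume_ball_band_le_of_saddle_dir_log hν p₀ u v hσpos hlam₂ hdet0 hr hvv huu hosc'
    f₀ ε hε hε2
  rwa [hdetuv, habs2s] at h

/-- Passing to `-ν`: smoothness, Hessian, and the band. [folklore] -/
private theorem neg_data (hν : ContDiff ℝ 2 ν) :
    ContDiff ℝ 2 (fun p => -ν p) ∧
    (∀ p, fderiv ℝ (fderiv ℝ (fun p => -ν p)) p = -fderiv ℝ (fderiv ℝ ν) p) ∧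
    (∀ f₀ ε : ℝ, {p : ℝ × ℝ | |f₀ + ν p| ≤ ε} = {p : ℝ × ℝ | |-f₀ + -ν p| ≤ ε}) := by
  have hfd : fderiv ℝ (fun p => -ν p) = fun p => -fderiv ℝ ν p := by
    funext p; exact fderiv_neg
  refine ⟨hν.neg, fun p => ?_, fun f₀ ε => ?_⟩
  · rw [hfd]; exact fderiv_neg
  · ext p
    simp only [mem_setOf_eq]
    rw [show -f₀ + -ν p = -(f₀ + ν p) by ring, abs_neg]

/-- `volume_ball_band_le_of_indefHessian_fst` for `∂₁²ν(p₀) ≤ -λ₁` (apply it to `-ν`).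
[cite: FeldmanSalmhoferTrubowitz1998, App. B (arXiv p.35 L47–112)] -/
theorem volume_ball_band_le_of_indefHessian_fst_neg (hν : ContDiff ℝ 2 ν) (p₀ : ℝ × ℝ)
    {r₀ w K lam₁ lam₀ Ω : ℝ} (hr₀ : 0 < r₀) (hw : 0 < w) (hK : 0 < K) (hlam₁ : 0 < lam₁)
    (ha : fderiv ℝ (fderiv ℝ ν) p₀ ((1 : ℝ), (0 : ℝ)) ((1 : ℝ), (0 : ℝ)) ≤ -lam₁)
    (haK : |fderiv ℝ (fderiv ℝ ν) p₀ ((1 : ℝ), (0 : ℝ)) ((1 : ℝ), (0 : ℝ))| ≤ K)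
    (hbK : |fderiv ℝ (fderiv ℝ ν) p₀ ((1 : ℝ), (0 : ℝ)) ((0 : ℝ), (1 : ℝ))| ≤ K)
    (hdet : fderiv ℝ (fderiv ℝ ν) p₀ ((1 : ℝ), (0 : ℝ)) ((1 : ℝ), (0 : ℝ)) *
        fderiv ℝ (fderiv ℝ ν) p₀ ((0 : ℝ), (1 : ℝ)) ((0 : ℝ), (1 : ℝ)) -
        (fderiv ℝ (fderiv ℝ ν) p₀ ((1 : ℝ), (0 : ℝ)) ((0 : ℝ), (1 : ℝ))) ^ 2 ≤ -w)
    (hmod : ∀ p ∈ Metric.ball p₀ r₀,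
      ‖fderiv ℝ (fderiv ℝ ν) p - fderiv ℝ (fderiv ℝ ν) p₀‖ ≤ lam₀)
    (hlam₀ : lam₀ ≤ lam₁ / 2) (hlam₀' : lam₀ * K ^ 2 ≤ lam₁ * w / 2)
    (hosc : ∀ p ∈ Metric.ball p₀ r₀, ∀ q ∈ Metric.ball p₀ r₀, ν p - ν q ≤ Ω)
    (f₀ ε : ℝ) (hε : 0 < ε) (hε2 : ε ≤ 1 / 2) :
    volume (Metric.ball p₀ (r₀ * lam₁ / (2 * (K + 1) * (2 * K + 1))) ∩
        {p : ℝ × ℝ | |f₀ + ν p| ≤ ε}) ≤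
      ENNReal.ofReal (K * ((80 + 35 * Real.log (Ω + 1)) / (lam₁ * min 1 w / 2) * ε *
        (1 + |Real.log ε|))) := by
  obtain ⟨hC, hfd2, hset⟩ := neg_data hν
  rw [hset]
  refine volume_ball_band_le_of_indefHessian_fst hC p₀ hr₀ hw hK hlam₁ ?_ ?_ ?_ ?_ ?_ hlam₀
    hlam₀' ?_ (-f₀) ε hε hε2
  · rw [hfd2, neg_apply, neg_apply]; linarith
  · rw [hfd2, neg_apply, neg_apply, abs_neg]; exact haK
  · rw [hfd2, neg_apply, neg_apply, abs_neg]; exact hbK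
  · simp only [hfd2, neg_apply]; nlinarith
  · intro p hp
    rw [hfd2, hfd2, show -fderiv ℝ (fderiv ℝ ν) p - -fderiv ℝ (fderiv ℝ ν) p₀ =
      -(fderiv ℝ (fderiv ℝ ν) p - fderiv ℝ (fderiv ℝ ν) p₀) by abel, ContinuousLinearMap.opNorm_neg]
    exact hmod p hp
  · intro p hp q hq
    have := hosc q hq p hp
    linarith

/-- `volume_ball_band_le_of_indefHessian_snd` for `∂₂²ν(p₀) ≤ -λ₁` (apply it to `-ν`).
[cite: FeldmanSalmhoferTrubowitz1998, App. B (arXiv p.35 L47–112)] -/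
theorem volume_ball_band_le_of_indefHessian_snd_neg (hν : ContDiff ℝ 2 ν) (p₀ : ℝ × ℝ)
    {r₀ w K lam₁ lam₀ Ω : ℝ} (hr₀ : 0 < r₀) (hw : 0 < w) (hK : 0 < K) (hlam₁ : 0 < lam₁)
    (hc : fderiv ℝ (fderiv ℝ ν) p₀ ((0 : ℝ), (1 : ℝ)) ((0 : ℝ), (1 : ℝ)) ≤ -lam₁)
    (hcK : |fderiv ℝ (fderiv ℝ ν) p₀ ((0 : ℝ), (1 : ℝ)) ((0 : ℝ), (1 : ℝ))| ≤ K)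
    (hbK : |fderiv ℝ (fderiv ℝ ν) p₀ ((1 : ℝ), (0 : ℝ)) ((0 : ℝ), (1 : ℝ))| ≤ K)
    (hdet : fderiv ℝ (fderiv ℝ ν) p₀ ((1 : ℝ), (0 : ℝ)) ((1 : ℝ), (0 : ℝ)) *
        fderiv ℝ (fderiv ℝ ν) p₀ ((0 : ℝ), (1 : ℝ)) ((0 : ℝ), (1 : ℝ)) -
        (fderiv ℝ (fderiv ℝ ν) p₀ ((1 : ℝ), (0 : ℝ)) ((0 : ℝ), (1 : ℝ))) ^ 2 ≤ -w)
    (hmod : ∀ p ∈ Metric.ball p₀ r₀,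
      ‖fderiv ℝ (fderiv ℝ ν) p - fderiv ℝ (fderiv ℝ ν) p₀‖ ≤ lam₀)
    (hlam₀ : lam₀ ≤ lam₁ / 2) (hlam₀' : lam₀ * K ^ 2 ≤ lam₁ * w / 2)
    (hosc : ∀ p ∈ Metric.ball p₀ r₀, ∀ q ∈ Metric.ball p₀ r₀, ν p - ν q ≤ Ω)
    (f₀ ε : ℝ) (hε : 0 < ε) (hε2 : ε ≤ 1 / 2) :
    volume (Metric.ball p₀ (r₀ * lam₁ / (2 * (K + 1) * (2 * K + 1))) ∩
        {p : ℝ × ℝ | |f₀ + ν p| ≤ ε}) ≤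
      ENNReal.ofReal (K * ((80 + 35 * Real.log (Ω + 1)) / (lam₁ * min 1 w / 2) * ε *
        (1 + |Real.log ε|))) := by
  obtain ⟨hC, hfd2, hset⟩ := neg_data hν
  rw [hset]
  refine volume_ball_band_le_of_indefHessian_snd hC p₀ hr₀ hw hK hlam₁ ?_ ?_ ?_ ?_ ?_ hlam₀
    hlam₀' ?_ (-f₀) ε hε hε2
  · rw [hfd2, neg_apply, neg_apply]; linarith
  · rw [hfd2, neg_apply, neg_apply, abs_neg]; exact hcK
  · rw [hfd2, neg_apply, neg_apply, abs_neg]; exact hbK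
  · simp only [hfd2, neg_apply]; nlinarith
  · intro p hp
    rw [hfd2, hfd2, show -fderiv ℝ (fderiv ℝ ν) p - -fderiv ℝ (fderiv ℝ ν) p₀ =
      -(fderiv ℝ (fderiv ℝ ν) p - fderiv ℝ (fderiv ℝ ν) p₀) by abel, ContinuousLinearMap.opNorm_neg]
    exact hmod p hp
  · intro p hp q hq
    have := hosc q hq p hp
    linarith

set_option maxHeartbeats 400000 in
/-- **Quantitative hyperbolic (saddle) bound from the Hessian entries at a point — all cases**
(App. B p.35 L47–112 with the linear normalisation explicit and quantitative; the saddle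
analogue of `volume_band_le_of_posDef_hessian_at`). Data: the Hessian entries `a, b, c` of
`ν ∈ C²` at `p₀` with `|a|, |b|, |c| ≤ K` and `ac - b² ≤ -w < 0`; on the sup-norm ball
`B_{r₀}(p₀)`: `‖D²ν(p) - D²ν(p₀)‖ ≤ λ₀` with `λ₀ ≤ √w/8` and `λ₀K² ≤ w√w/8`, and oscillation
`≤ Ω`. Then for all `f₀` and `0 < ε ≤ 1/2`, with `λ₁ = √w/4`,
`vol{p ∈ B_r(p₀) : |f₀ + ν p| ≤ ε} ≤ (C_A + C_C)·ε(1+|log ε|)` where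
`r = min(r₀λ₁/(2(K+1)(2K+1)), r₀/8)`, `C_A = K(80+35 log(Ω+1))/(λ₁ min(1,w)/2)`,
`C_C = 2(80+35 log(Ω+1))/(√w/2)` — constants from `(w, K, r₀, Ω)` only, hence uniform over
families sharing them. Cases `a ≥ λ₁` / `a ≤ -λ₁` / `c ≥ λ₁` / `c ≤ -λ₁` are the `fst`/`snd`
lemmas and their `-ν` versions; otherwise `b² ≥ w - λ₁² ≥ 9w/16`, so `|b| ≥ 3√w/4` and the
diagonal directions `(1, ±1)` work with `λ₂ = √w/2`.
[cite: FeldmanSalmhoferTrubowitz1998, App. B (arXiv p.35 L47–112)] -/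
theorem volume_ball_band_le_of_indefHessian_at (hν : ContDiff ℝ 2 ν) (p₀ : ℝ × ℝ)
    {r₀ w K lam₀ Ω : ℝ} (hr₀ : 0 < r₀) (hw : 0 < w) (hK : 0 < K)
    (haK : |fderiv ℝ (fderiv ℝ ν) p₀ ((1 : ℝ), (0 : ℝ)) ((1 : ℝ), (0 : ℝ))| ≤ K)
    (hbK : |fderiv ℝ (fderiv ℝ ν) p₀ ((1 : ℝ), (0 : ℝ)) ((0 : ℝ), (1 : ℝ))| ≤ K)
    (hcK : |fderiv ℝ (fderiv ℝ ν) p₀ ((0 : ℝ), (1 : ℝ)) ((0 : ℝ), (1 : ℝ))| ≤ K)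
    (hdet : fderiv ℝ (fderiv ℝ ν) p₀ ((1 : ℝ), (0 : ℝ)) ((1 : ℝ), (0 : ℝ)) *
        fderiv ℝ (fderiv ℝ ν) p₀ ((0 : ℝ), (1 : ℝ)) ((0 : ℝ), (1 : ℝ)) -
        (fderiv ℝ (fderiv ℝ ν) p₀ ((1 : ℝ), (0 : ℝ)) ((0 : ℝ), (1 : ℝ))) ^ 2 ≤ -w)
    (hmod : ∀ p ∈ Metric.ball p₀ r₀,
      ‖fderiv ℝ (fderiv ℝ ν) p - fderiv ℝ (fderiv ℝ ν) p₀‖ ≤ lam₀)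
    (hlam₀ : lam₀ ≤ Real.sqrt w / 8) (hlam₀' : lam₀ * K ^ 2 ≤ Real.sqrt w * w / 8)
    (hosc : ∀ p ∈ Metric.ball p₀ r₀, ∀ q ∈ Metric.ball p₀ r₀, ν p - ν q ≤ Ω)
    (f₀ ε : ℝ) (hε : 0 < ε) (hε2 : ε ≤ 1 / 2) :
    volume (Metric.ball p₀ (min (r₀ * (Real.sqrt w / 4) / (2 * (K + 1) * (2 * K + 1))) (r₀ / 8)) ∩
        {p : ℝ × ℝ | |f₀ + ν p| ≤ ε}) ≤
      ENNReal.ofReal ((K * ((80 + 35 * Real.log (Ω + 1)) / (Real.sqrt w / 4 * min 1 w / 2)) +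
        2 * ((80 + 35 * Real.log (Ω + 1)) / (Real.sqrt w / 2))) * ε * (1 + |Real.log ε|)) := by
  set a := fderiv ℝ (fderiv ℝ ν) p₀ ((1 : ℝ), (0 : ℝ)) ((1 : ℝ), (0 : ℝ)) with ha'
  set b := fderiv ℝ (fderiv ℝ ν) p₀ ((1 : ℝ), (0 : ℝ)) ((0 : ℝ), (1 : ℝ)) with hb'
  set c := fderiv ℝ (fderiv ℝ ν) p₀ ((0 : ℝ), (1 : ℝ)) ((0 : ℝ), (1 : ℝ)) with hc'
  set sw := Real.sqrt w with hsw
  have hswpos : 0 < sw := Real.sqrt_pos.2 hw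
  have hsw2 : sw ^ 2 = w := Real.sq_sqrt hw.le
  set lam₁ := sw / 4 with hlam₁
  have hlam₁pos : 0 < lam₁ := by positivity
  have hl0a : lam₀ ≤ lam₁ / 2 := by rw [hlam₁]; linarith
  have hl0b : lam₀ * K ^ 2 ≤ lam₁ * w / 2 := by rw [hlam₁]; linarith
  set L := 80 + 35 * Real.log (Ω + 1) with hL
  have hΩ : 0 ≤ Ω := by
    have := hosc p₀ (Metric.mem_ball_self hr₀) p₀ (Metric.mem_ball_self hr₀); linarith
  have hL0 : 0 ≤ L := by
    have : 0 ≤ Real.log (Ω + 1) := Real.log_nonneg (by linarith)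
    rw [hL]; positivity
  have hminpos : 0 < min 1 w := lt_min one_pos hw
  set CA := K * (L / (lam₁ * min 1 w / 2)) with hCA
  set CC := 2 * (L / (sw / 2)) with hCC
  have hCA0 : 0 ≤ CA := by positivity
  have hCC0 : 0 ≤ CC := by positivity
  set rA := r₀ * lam₁ / (2 * (K + 1) * (2 * K + 1)) with hrA
  set W := {p : ℝ × ℝ | |f₀ + ν p| ≤ ε} with hW
  have hE : 0 ≤ ε * (1 + |Real.log ε|) := by positivity
  have mono_ball : ∀ r', min rA (r₀ / 8) ≤ r' →
      volume (Metric.ball p₀ (min rA (r₀ / 8)) ∩ W) ≤ volume (Metric.ball p₀ r' ∩ W) :=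
    fun r' h => measure_mono (inter_subset_inter_left _ (Metric.ball_subset_ball h))
  have final_A : ENNReal.ofReal (K * (L / (lam₁ * min 1 w / 2) * ε * (1 + |Real.log ε|))) ≤
      ENNReal.ofReal ((CA + CC) * ε * (1 + |Real.log ε|)) := by
    apply ENNReal.ofReal_le_ofReal
    have h1 : K * (L / (lam₁ * min 1 w / 2) * ε * (1 + |Real.log ε|)) =
        CA * (ε * (1 + |Real.log ε|)) := by rw [hCA]; ring
    have h2 : (CA + CC) * ε * (1 + |Real.log ε|) =
        CA * (ε * (1 + |Real.log ε|)) + CC * (ε * (1 + |Real.log ε|)) := by ring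
    rw [h1, h2]
    linarith [mul_nonneg hCC0 hE]
  have final_C : ENNReal.ofReal (2 * (L / (sw / 2) * ε * (1 + |Real.log ε|))) ≤
      ENNReal.ofReal ((CA + CC) * ε * (1 + |Real.log ε|)) := by
    apply ENNReal.ofReal_le_ofReal
    have h1 : 2 * (L / (sw / 2) * ε * (1 + |Real.log ε|)) = CC * (ε * (1 + |Real.log ε|)) := by
      rw [hCC]; ring
    have h2 : (CA + CC) * ε * (1 + |Real.log ε|) =
        CA * (ε * (1 + |Real.log ε|)) + CC * (ε * (1 + |Real.log ε|)) := by ring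
    rw [h1, h2]
    linarith [mul_nonneg hCA0 hE]
  rcases le_or_gt lam₁ a with h1 | h1
  · exact (mono_ball rA (min_le_left _ _)).trans
      ((volume_ball_band_le_of_indefHessian_fst hν p₀ hr₀ hw hK hlam₁pos h1 haK hbK hdet hmod
        hl0a hl0b hosc f₀ ε hε hε2).trans final_A)
  rcases le_or_gt a (-lam₁) with h2 | h2
  · exact (mono_ball rA (min_le_left _ _)).trans
      ((volume_ball_band_le_of_indefHessian_fst_neg hν p₀ hr₀ hw hK hlam₁pos h2 haK hbK hdet
        hmod hl0a hl0b hosc f₀ ε hε hε2).trans final_A)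
  rcases le_or_gt lam₁ c with h3 | h3
  · exact (mono_ball rA (min_le_left _ _)).trans
      ((volume_ball_band_le_of_indefHessian_snd hν p₀ hr₀ hw hK hlam₁pos h3 hcK hbK hdet hmod
        hl0a hl0b hosc f₀ ε hε hε2).trans final_A)
  rcases le_or_gt c (-lam₁) with h4 | h4
  · exact (mono_ball rA (min_le_left _ _)).trans
      ((volume_ball_band_le_of_indefHessian_snd_neg hν p₀ hr₀ hw hK hlam₁pos h4 hcK hbK hdet
        hmod hl0a hl0b hosc f₀ ε hε hε2).trans final_A)
  -- both diagonal entries small: the off-diagonal entry is large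
  have haa : |a| ≤ lam₁ := abs_le.2 ⟨h2.le, h1.le⟩
  have hcc : |c| ≤ lam₁ := abs_le.2 ⟨h4.le, h3.le⟩
  have hac : -(lam₁ * lam₁) ≤ a * c := by
    have : |a * c| ≤ lam₁ * lam₁ := by
      rw [abs_mul]; exact mul_le_mul haa hcc (abs_nonneg _) hlam₁pos.le
    linarith [neg_abs_le (a * c)]
  have hl1sq : lam₁ * lam₁ = w / 16 := by rw [hlam₁]; nlinarith [hsw2]
  have hb2 : (3 * sw / 4) ^ 2 ≤ b ^ 2 := by nlinarith [hsw2]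
  have hb3 : 3 * sw / 4 ≤ |b| := by
    have := Real.sqrt_le_sqrt hb2
    rwa [Real.sqrt_sq (by positivity), Real.sqrt_sq_eq_abs] at this
  set lam₂ := sw / 2 with hlam₂
  have hlam₂pos : 0 < lam₂ := by positivity
  have hl0c : lam₀ ≤ lam₂ := by rw [hlam₂]; linarith
  rcases le_or_gt 0 b with hb | hb
  · have hbabs : |b| = b := abs_of_nonneg hb
    rw [hbabs] at hb3
    have hvH : 2 * lam₂ ≤ a + 2 * 1 * b + c := by
      rw [hlam₂]; linarith [(abs_le.1 haa).1, (abs_le.1 hcc).1]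
    have huH : a - 2 * 1 * b + c ≤ -(2 * lam₂) := by
      rw [hlam₂]; linarith [(abs_le.1 haa).2, (abs_le.1 hcc).2]
    exact (mono_ball (r₀ / 8) (min_le_right _ _)).trans
      ((volume_ball_band_le_of_indefHessian_diag hν p₀ hr₀ hlam₂pos (Or.inl rfl) hvH huH hmod
        hl0c hosc f₀ ε hε hε2).trans final_C)
  · have hbabs : |b| = -b := abs_of_neg hb
    rw [hbabs] at hb3
    have hvH : 2 * lam₂ ≤ a + 2 * (-1) * b + c := by
      rw [hlam₂]; linarith [(abs_le.1 haa).1, (abs_le.1 hcc).1]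
    have huH : a - 2 * (-1) * b + c ≤ -(2 * lam₂) := by
      rw [hlam₂]; linarith [(abs_le.1 haa).2, (abs_le.1 hcc).2]
    exact (mono_ball (r₀ / 8) (min_le_right _ _)).trans
      ((volume_ball_band_le_of_indefHessian_diag hν p₀ hr₀ hlam₂pos (Or.inr rfl) hvH huH hmod
        hl0c hosc f₀ ε hε hε2).trans final_C)

end IndefiniteHessian

end Literature.MathematicalPhysics.QuantumLattice.FermiRG

end
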